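import Mathlib
import HarnessLib
import Summits.HubbardSuperconductivity.HubbardSuperconductivity.Theorems.KLProgrammeKLRegimeEngineFrameShiftSymbolMomentsFrames
import Summits.HubbardSuperconductivity.HubbardSuperconductivity.Theorems.KLProgrammeKLRegimeSplitSlotsV17F2

/-!
# K3 gen-8-FLOW (stmt 20437 `KLRegimeEngineV17F2`, stub (C), door (B)): the symbol-difference moments ON THE FLOW FRAMES `(K_n, K_{n+1})` from the
# PIECE jet tables only

Cell gate-hubbard-kl, seat p2 g11.  On the flow `K_{n+1} = K_n ⊖ klFlowPiece n` (`klFlowFrameU_succ`, `eval_klFlowFrameU`: `K_n = −Σ_{m<n} klFlowPiece m`)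
the frame tables of `…EngineFrameShiftSymbolMomentsFrames.frameShift_symbol_moment_le_of_frameJets` are sums of PIECE tables: with any
`pj m j ≥ ‖Dʲ evalM (klFlowPiece m)‖` (`m ≤ n`, `j ≤ r+2`; for `j ≤ 4` the (I-F jets) row `R.Gfr j·uPow j U·4^{(j−2)m}` of `FlowPieceJetsAt`, for `j ≥ 1`
(in particular `5, 6`) the gradient-row bound of `…FlowPieceJetsAllOrders`), `κ_j = Σ_{m<n} pj m j` and `W_j = pj n j`:

* `norm_iteratedFDeriv_evalM_klFlowFrameU_le_sum` — `‖Dʲ evalM K_n (q)‖ ≤ Σ_{m<n} pj m j`;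
* `norm_iteratedFDeriv_evalM_klFlowFrameU_succ_sub_eq` — `‖Dʲ(evalM K_{n+1} − evalM K_n)(q)‖ = ‖Dʲ evalM (klFlowPiece n)(q)‖`;
* **`frameShift_symbol_moment_le_flow`** — `Σ_x (1+|x̃₀|+|x̃₁|)^r·‖𝔉⁻¹[k⃗ ↦ Ψ_{K_{n+1}}((ω_i,k⃗),σ) − Ψ_{K_n}((ω_i,k⃗),σ)](x)‖ ≤ 21·3^r·𝒥` under the fit
  `4 + Σ_{m<n} pj m j + pj n j ≤ d·(6/m)^{j−1}` (`1 ≤ j ≤ r+2`, `m = max(|ω_i|, Λ/2)`) and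
  `(π/2)^k·Σ_{j≤k} C(k,j)(j!(A·j!)(max(d,1)·6/m)ʲ)·pj n (k−j) ≤ 𝒥` (`k ≤ r+2`), `A = 2βL²B(2/m)²` — the `hD` input of
  `moment_selfEnergy_frameShift_sub_le` at `(K₀, K₁) = (K_n, K_{n+1})`, every `Λ` (read at `Λ = Λ_n`).

Proofs only; the tables, the fit and `𝒥` are hypotheses (the registrant's arithmetic); nothing asserts superconductivity.
References: BGM 2006 §2.2 (2.23), §3 (3.2)–(3.8) [cite: BenfattoGiulianiMastropietro2006].
-/

noncomputable section

namespace Summit.HubbardSuperconductivity.HubbardSuperconductivity.Theorems.EngineV8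

set_option linter.dupNamespace false -- summit = problem name (single-conjunct summit), D-0017

open Finset Literature.MathematicalPhysics.QuantumLattice Literature.Probability.LatticeModels Set
open Summit.HubbardSuperconductivity.HubbardSuperconductivity.Theorems.KLRegimeSplit
open Summit.HubbardSuperconductivity.HubbardSuperconductivity.Theorems.DispersionFlow
open scoped Nat

variable {L M : ℕ} [NeZero L] [NeZero M]

/-! ## §1 Jets of the flow frame and of one flow step from the piece tables -/

/-- `evalM K_n = −Σ_{m<n} evalM (klFlowPiece m)` as functions. -/
theorem evalM_klFlowFrameU_eq_neg_sum (β U μ : ℝ) (n : ℕ) :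
    evalM (klFlowFrameU L M β U μ n) = fun q => -∑ m ∈ range n, evalM (klFlowPiece L M β U μ m) q := by
  funext q
  simp only [evalM_apply, eval_klFlowFrameU]

/-- **`‖Dʲ evalM K_n (q)‖ ≤ Σ_{m<n} pj m j`** from piece tables `‖Dʲ evalM (klFlowPiece m)(q)‖ ≤ pj m j` (`m < n`). -/
theorem norm_iteratedFDeriv_evalM_klFlowFrameU_le_sum {β U μ : ℝ} {n j : ℕ} {pj : ℕ → ℕ → ℝ}
    (hpj : ∀ m < n, ∀ q : Momentum, ‖iteratedFDeriv ℝ j (evalM (klFlowPiece L M β U μ m)) q‖ ≤ pj m j) (q : Momentum) :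
    ‖iteratedFDeriv ℝ j (evalM (klFlowFrameU L M β U μ n)) q‖ ≤ ∑ m ∈ range n, pj m j := by
  have hfun : evalM (klFlowFrameU L M β U μ n) = fun q => (-1 : ℝ) • ∑ m ∈ range n, evalM (klFlowPiece L M β U μ m) q := by
    rw [evalM_klFlowFrameU_eq_neg_sum]; funext q; simp
  have hsum : ContDiff ℝ j (fun q : Momentum => ∑ m ∈ range n, evalM (klFlowPiece L M β U μ m) q) :=
    ContDiff.sum fun m _ => contDiff_evalM _
  rw [hfun, iteratedFDeriv_const_smul_apply' hsum.contDiffAt, norm_smul, Real.norm_eq_abs, abs_neg, abs_one, one_mul,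
    iteratedFDeriv_fun_sum_apply fun m _ => (contDiff_evalM (klFlowPiece L M β U μ m)).contDiffAt]
  exact (norm_sum_le _ _).trans (sum_le_sum fun m hm => hpj m (mem_range.mp hm) q)

/-- **One flow step**: `‖Dʲ(evalM K_{n+1} − evalM K_n)(q)‖ = ‖Dʲ evalM (klFlowPiece n)(q)‖`. -/
theorem norm_iteratedFDeriv_evalM_klFlowFrameU_succ_sub_eq (β U μ : ℝ) (n j : ℕ) (q : Momentum) :
    ‖iteratedFDeriv ℝ j (fun q => evalM (klFlowFrameU L M β U μ (n + 1)) q - evalM (klFlowFrameU L M β U μ n) q) q‖ =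
      ‖iteratedFDeriv ℝ j (evalM (klFlowPiece L M β U μ n)) q‖ := by
  have hfun : (fun q => evalM (klFlowFrameU L M β U μ (n + 1)) q - evalM (klFlowFrameU L M β U μ n) q) =
      fun q => (-1 : ℝ) • evalM (klFlowPiece L M β U μ n) q := by
    funext q
    rw [klFlowFrameU_succ, evalM_fsub, smul_eq_mul]
    ring
  rw [hfun, iteratedFDeriv_const_smul_apply' (contDiff_evalM _).contDiffAt, norm_smul, Real.norm_eq_abs, abs_neg, abs_one, one_mul]

/-! ## §2 The symbol-difference moments on the flow -/

/-- **THE SYMBOL-DIFFERENCE MOMENTS ON THE FLOW FRAMES from the piece jet tables**: with `m = max(|ω_i|, Λ/2)`, `A = 2βL²B(2/m)²`, piece tables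
`‖Dʲ evalM (klFlowPiece m')(q)‖ ≤ pj m' j` for `m' ≤ n`, `j ≤ r+2`, the fit `4 + Σ_{m'<n} pj m' j + pj n j ≤ d·(6/m)^{j−1}` (`1 ≤ j ≤ r+2`), cutoff
derivatives `≤ B` to order `N ≥ r+4`, and `(π/2)^k·Σ_{j≤k} C(k,j)·(j!·(A·j!)·(max(d,1)·6/m)ʲ)·pj n (k−j) ≤ 𝒥` (`k ≤ r+2`):
`Σ_x (1+|x̃₀|+|x̃₁|)^r·‖𝔉⁻¹[k⃗ ↦ Ψ_{K_{n+1}}((ω_i,k⃗),σ) − Ψ_{K_n}((ω_i,k⃗),σ)](x)‖ ≤ 21·3^r·𝒥`. -/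
theorem frameShift_symbol_moment_le_flow {β : ℝ} (hβ : 0 < β) {Λ : ℝ} (hΛ : 0 < Λ) {N : ℕ} {B : ℝ} (hB1 : 1 ≤ B)
    (hB : ∀ i ≤ N, ∀ t, ‖iteratedDeriv i salmhoferCutoff t‖ ≤ B) (r : ℕ) (hN : r + 4 ≤ N) (U μ : ℝ) (n : ℕ)
    (i : MatsubaraIdx M) (σ : Fin 2) {pj : ℕ → ℕ → ℝ}
    (hpj : ∀ m ≤ n, ∀ j ≤ r + 2, ∀ q : Momentum, ‖iteratedFDeriv ℝ j (evalM (klFlowPiece L M β U μ m)) q‖ ≤ pj m j)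
    {d : ℝ} (hfit : ∀ j, 1 ≤ j → j ≤ r + 2 → 4 + ∑ m ∈ range n, pj m j + pj n j ≤ d * (6 / max |matsubaraFreq β M i| (Λ / 2)) ^ (j - 1))
    {J : ℝ}
    (hJ : ∀ k ≤ r + 2, (Real.pi / 2) ^ k * ∑ j ∈ Finset.range (k + 1), (k.choose j : ℝ) *
      (j ! * ((2 * (β * (L : ℝ) ^ 2) * B * (2 / max |matsubaraFreq β M i| (Λ / 2)) ^ 2) * j !) *
        (max d 1 * (6 / max |matsubaraFreq β M i| (Λ / 2))) ^ j) * pj n (k - j) ≤ J) :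
    ∑ x : TorusSite 2 L, (1 + ((x 0).valMinAbs.natAbs : ℝ) + ((x 1).valMinAbs.natAbs : ℝ)) ^ r *
        ‖torusFourierInv (fun kv : TorusSite 2 L =>
          uvSymbolCT L M β μ (klFlowFrameU L M β U μ (n + 1)) Λ ((i, kv), σ) - uvSymbolCT L M β μ (klFlowFrameU L M β U μ n) Λ ((i, kv), σ)) x‖ ≤
      21 * 3 ^ r * J :=
  frameShift_symbol_moment_le_of_frameJets hβ hΛ hB1 hB r hN μ (klFlowFrameU L M β U μ n) (klFlowFrameU L M β U μ (n + 1)) i σ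
    (κ := fun j => ∑ m ∈ range n, pj m j) (W := fun j => pj n j)
    (fun j _ hj2 q => norm_iteratedFDeriv_evalM_klFlowFrameU_le_sum (fun m hm q => hpj m hm.le j hj2 q) q)
    (fun j hj q => by rw [norm_iteratedFDeriv_evalM_klFlowFrameU_succ_sub_eq]; exact hpj n le_rfl j hj q)
    hfit hJ

end Summit.HubbardSuperconductivity.HubbardSuperconductivity.Theorems.EngineV8

end
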